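import Summits.NavierStokesRegularity.FluidComputer.AngularGalerkinLadderRadialCutoff
import Summits.NavierStokesRegularity.FluidComputer.AngularGalerkinLadderLaplacian
import Literature.Analysis.FluidPDE.HomogeneousEulerProofs
import HarnessLib

/-!
# The toroidal lift `u ↦ (x ↦ x × u(x))` on the angular Galerkin ladder: it commutes with every
# rotation generator, the Casimir and the band defects, and toroidal fields `x × ∇φ(x)` (with
# radial cut-offs) are divergence free
# (route `AngularGalerkinLadder`, crux K1 `RungBlowupCofinal`; kinematic helper, theorems only)

Cell `ns-blowup`, seat `ns-blowup-circuit` (g11, AGL Lean seat). Helper file for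
`stmt-NavierStokesRegularity-19959` (K1 of route №8) serving the line
`Cruxes/RungBlowupCofinal/Lines/qlwave.lean` (mean–wave rung profiles), FIRST PROVER TARGET (S1) of its
card «kinematic non-vacuity of the sector at every level» — part 1 of 3 (this file: the lift;
`SectoralHarmonics.lean`: the scalar sectoral harmonics; `SectoralToroidalWaves.lean`: the witnesses).
LABEL: KERNEL kinematics. Nothing here asserts a Theses declaration; no definition, no named fact.
WHAT THIS IS NOT: not Navier–Stokes evidence — vector-calculus identities for smooth fields on
`ℝ³` in the vocabulary of `FluidComputer/AngularGalerkinLadder.lean`; no rung dynamics, no profile.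

## Content

* `fderiv_crossSelf_apply`, `contDiff_crossSelf` — calculus of the lift `x ↦ x × u(x)`.
* **`angGen_crossSelf`**: `J_a (x ↦ x × u(x)) = (x ↦ x × (J_a u)(x))` — the lift is
  `SO(3)`-equivariant; at the level of the generators `J_a u = e_a × u − ((e_a × x)·∇)u` this is the
  Jacobi identity `e_a × (x × u) − (e_a × x) × u = x × (e_a × u)`. Hence **`casimir_crossSelf`**,
  **`bandDefect_crossSelf`**, **`isBandLimited_crossSelf`** (band-limited in, band-limited out),
  `casimir_crossSelf_of_eq_smul` (`𝒞`-eigenfields to `𝒞`-eigenfields), `wave_crossSelf`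
  (`n`-fold azimuthal waves `J₃²u = −n²u` to `n`-fold waves), `zonal_crossSelf`.
* **`isDivFree_crossSelf_gradient`**: `div (x × ∇φ(x)) = −Σ_i D²φ(x)(e_i, x × e_i) = 0` (a
  symmetric form traced against the skew map `x × ·`, tree `sum_apply_clm_apply_eq_zero_of_skew`),
  and **`isDivFree_radial_crossSelf_gradient`**: `div (χ(‖x‖²) x × ∇φ(x)) = 0` (toroidal fields are
  tangent to spheres, tree `fderiv_radial_apply_cross`).

These are the two facts about the TOROIDAL vector spherical harmonics `x × ∇(f(r)Y_{jm})` that the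
mean–wave line needs kinematically: they stay in the isotype of their scalar, and they are
solenoidal under any radial profile. [cite: BullardGellman1954] (toroidal/poloidal vector spherical
harmonics; here projection-free, in the tree's Casimir-cut typing).
-/

noncomputable section

namespace Summit.NavierStokesRegularity.AngularGalerkinLadderToroidalLift

open Set Function
open scoped ContDiff RealInnerProductSpace
open Literature.Analysis.FluidPDE
open Summit.NavierStokesRegularity.FluidComputer
open Summit.NavierStokesRegularity.FluidComputer.AngularLadder

variable {u : EuclideanSpace ℝ (Fin 3) → EuclideanSpace ℝ (Fin 3)} {L : ℕ}
  {x : EuclideanSpace ℝ (Fin 3)}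

/-! ## §1 The lift `u ↦ (x ↦ x × u(x))` commutes with the rotation generators -/

/-- `x × (v − w) = x × v − x × w`. [folklore] -/
private theorem cross_sub_right (z v w : EuclideanSpace ℝ (Fin 3)) : cross z (v - w) = cross z v - cross z w :=
  map_sub (crossCLM z) v w

/-- `x × (c • v) = c • (x × v)`. [folklore] -/
private theorem cross_smul_right (z : EuclideanSpace ℝ (Fin 3)) (c : ℝ) (v : EuclideanSpace ℝ (Fin 3)) :
    cross z (c • v) = c • cross z v :=
  map_smul (crossCLM z) c v

/-- `x × (−v) = −(x × v)`. [folklore] -/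
private theorem cross_neg_right (z v : EuclideanSpace ℝ (Fin 3)) : cross z (-v) = -cross z v :=
  map_neg (crossCLM z) v

/-- `x × 0 = 0`. [folklore] -/
private theorem cross_zero_right (z : EuclideanSpace ℝ (Fin 3)) : cross z 0 = 0 :=
  map_zero (crossCLM z)

/-- `x × Σᵢ vᵢ = Σᵢ x × vᵢ`. [folklore] -/
private theorem cross_sum_right {ι : Type*} (s : Finset ι) (z : EuclideanSpace ℝ (Fin 3))
    (v : ι → EuclideanSpace ℝ (Fin 3)) : cross z (∑ i ∈ s, v i) = ∑ i ∈ s, cross z (v i) :=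
  map_sum (crossCLM z) v s

/-- `v × w = −(w × v)`. [folklore] -/
private theorem cross_swap (v w : EuclideanSpace ℝ (Fin 3)) : cross v w = -cross w v := by
  apply PiLp.ext
  intro i
  fin_cases i <;> simp [cross, cross_apply] <;> ring

/-- Jacobi in the form used by the generators:
`e × (x × v) − (e × x) × v = x × (e × v)`. [folklore] -/
private theorem cross_cross_sub (e z v : EuclideanSpace ℝ (Fin 3)) :
    cross e (cross z v) - cross (cross e z) v = cross z (cross e v) := by
  apply PiLp.ext
  intro i
  fin_cases i <;> simp [cross, cross_apply] <;> ring

/-- The derivative of the toroidalisation: `D(x ↦ x × u(x))(x) w = w × u(x) + x × Du(x) w`.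
[folklore] -/
theorem fderiv_crossSelf_apply (hu : DifferentiableAt ℝ u x) (w : EuclideanSpace ℝ (Fin 3)) :
    fderiv ℝ (fun y => cross y (u y)) x w = cross w (u x) + cross x (fderiv ℝ u x w) := by
  have h : HasFDerivAt (fun y => cross y (u y))
      (crossCLM.precompR (EuclideanSpace ℝ (Fin 3)) x (fderiv ℝ u x) +
        crossCLM.precompL (EuclideanSpace ℝ (Fin 3)) (ContinuousLinearMap.id ℝ _) (u x)) x :=
    hasFDerivAt_cross (hasFDerivAt_id x) hu.hasFDerivAt
  rw [h.fderiv]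
  simp only [_root_.add_apply, ContinuousLinearMap.precompR_apply, ContinuousLinearMap.compL_apply,
    ContinuousLinearMap.coe_comp, Function.comp_apply, ContinuousLinearMap.precompL_apply,
    crossCLM_apply, ContinuousLinearMap.coe_id', id]
  exact add_comm _ _

/-- The toroidalisation of a smooth field is smooth. [folklore] -/
theorem contDiff_crossSelf (hu : ContDiff ℝ ∞ u) : ContDiff ℝ ∞ fun y => cross y (u y) := by
  have e : (fun y => cross y (u y)) = fun y => crossCLM y (u y) := rfl
  rw [e]
  exact crossCLM.contDiff.clm_apply hu

/-- **Toroidalisation commutes with every rotation generator**: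
`J_a (x ↦ x × u(x)) = (x ↦ x × (J_a u)(x))` (the map `u ↦ x × u` is `SO(3)`-equivariant; at the
generator level this is the Jacobi identity). [folklore] -/
theorem angGen_crossSelf (hu : Differentiable ℝ u) (a : Fin 3) :
    angGen a (fun y => cross y (u y)) = fun y => cross y (angGen a u y) := by
  funext y
  rw [angGen_eq, angGen_eq]
  simp only [crossCLM_apply, fderiv_crossSelf_apply (hu y), cross_sub_right]
  rw [← cross_cross_sub (axis a) y (u y)]
  abel

/-- **Toroidalisation commutes with the Casimir**. [folklore] -/
theorem casimir_crossSelf (hu : ContDiff ℝ ∞ u) :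
    casimir (fun y => cross y (u y)) = fun y => cross y (casimir u y) := by
  funext y
  have h1 : ∀ a : Fin 3, angGen a (angGen a fun z => cross z (u z)) =
      fun z => cross z (angGen a (angGen a u) z) := fun a => by
    rw [angGen_crossSelf (hu.differentiable (by simp)) a,
      angGen_crossSelf ((contDiff_angGen hu a).differentiable (by simp)) a]
  simp only [casimir, h1, cross_neg_right, cross_sum_right]

/-- **Toroidalisation commutes with every band defect**. [folklore] -/
theorem bandDefect_crossSelf (hu : ContDiff ℝ ∞ u) (L : ℕ) :
    bandDefect L (fun y => cross y (u y)) = fun y => cross y (bandDefect L u y) := by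
  induction L with
  | zero => exact casimir_crossSelf hu
  | succ L ih =>
      funext y
      change casimir (bandDefect L fun z => cross z (u z)) y -
          (((L : ℝ) + 1) * ((L : ℝ) + 2)) • bandDefect L (fun z => cross z (u z)) y =
        cross y (casimir (bandDefect L u) y - (((L : ℝ) + 1) * ((L : ℝ) + 2)) • bandDefect L u y)
      rw [ih, casimir_crossSelf (contDiff_bandDefect hu L), cross_sub_right, cross_smul_right]

/-- **Band-limited in, band-limited out**: the toroidalisation of a field band-limited of degree
`≤ L` is band-limited of degree `≤ L`. [folklore] -/
theorem isBandLimited_crossSelf (hu : IsBandLimited L u) :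
    IsBandLimited L fun y => cross y (u y) := by
  refine ⟨contDiff_crossSelf hu.1, fun y => ?_⟩
  rw [bandDefect_crossSelf hu.1 L]
  simp only [hu.2 y, cross_zero_right]

/-- Toroidalisation transports `𝒞`-eigenfields to `𝒞`-eigenfields. [folklore] -/
theorem casimir_crossSelf_of_eq_smul (hu : ContDiff ℝ ∞ u) {μ : ℝ} (hμ : casimir u = μ • u) :
    casimir (fun y => cross y (u y)) = μ • fun y => cross y (u y) := by
  rw [casimir_crossSelf hu, hμ]
  funext y
  simp only [Pi.smul_apply, cross_smul_right]

/-- Toroidalisation transports `n`-fold azimuthal waves (`J₃²u = −n²u`) to `n`-fold azimuthal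
waves. [folklore] -/
theorem wave_crossSelf (hu : ContDiff ℝ ∞ u) {ν : ℝ}
    (hwave : ∀ y, angGen 2 (angGen 2 u) y = -(ν • u y)) (y : EuclideanSpace ℝ (Fin 3)) :
    angGen 2 (angGen 2 fun z => cross z (u z)) y = -(ν • cross y (u y)) := by
  rw [angGen_crossSelf (hu.differentiable (by simp)) 2,
    angGen_crossSelf ((contDiff_angGen hu 2).differentiable (by simp)) 2]
  simp only [hwave y, cross_neg_right, cross_smul_right]

/-- Toroidalisation transports zonal fields (`J₃u = 0`) to zonal fields. [folklore] -/
theorem zonal_crossSelf (hu : Differentiable ℝ u) (hz : ∀ y, angGen 2 u y = 0)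
    (y : EuclideanSpace ℝ (Fin 3)) : angGen 2 (fun z => cross z (u z)) y = 0 := by
  rw [angGen_crossSelf hu 2]
  simp only [hz y, cross_zero_right]

/-! ## §2 Toroidal fields `x × ∇φ(x)` and their radial cut-offs are divergence free -/

section Toroidal

variable {φ : EuclideanSpace ℝ (Fin 3) → ℝ} {χ : ℝ → ℝ}

/-- The gradient field of a smooth function is smooth. [folklore] -/
private theorem contDiff_gradient (hφ : ContDiff ℝ ∞ φ) : ContDiff ℝ ∞ (gradient φ) := by
  set Lr : (EuclideanSpace ℝ (Fin 3) →L[ℝ] ℝ) →L[ℝ] EuclideanSpace ℝ (Fin 3) :=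
    (InnerProductSpace.toDual ℝ (EuclideanSpace ℝ (Fin 3))).symm.toContinuousLinearEquiv.toContinuousLinearMap
    with hLr
  have h1 : gradient φ = fun y => Lr (fderiv ℝ φ y) := rfl
  rw [h1]
  exact Lr.contDiff.comp (contDiff_infty_iff_fderiv.1 hφ).2

/-- `⟪D(∇φ)(x) h, w⟫ = D²φ(x)(h)(w)` for smooth `φ`. [folklore] -/
private theorem inner_fderiv_gradient_apply (hφ : ContDiff ℝ ∞ φ) (x h w : EuclideanSpace ℝ (Fin 3)) :
    ⟪fderiv ℝ (gradient φ) x h, w⟫ = fderiv ℝ (fderiv ℝ φ) x h w := by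
  set Lr : (EuclideanSpace ℝ (Fin 3) →L[ℝ] ℝ) →L[ℝ] EuclideanSpace ℝ (Fin 3) :=
    (InnerProductSpace.toDual ℝ (EuclideanSpace ℝ (Fin 3))).symm.toContinuousLinearEquiv.toContinuousLinearMap
    with hLr
  have hLapp : ∀ l : EuclideanSpace ℝ (Fin 3) →L[ℝ] ℝ,
      Lr l = (InnerProductSpace.toDual ℝ (EuclideanSpace ℝ (Fin 3))).symm l := fun l => rfl
  have h1 : gradient φ = fun y => Lr (fderiv ℝ φ y) := rfl
  have hd : DifferentiableAt ℝ (fderiv ℝ φ) x :=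
    (contDiff_infty_iff_fderiv.1 hφ).2.differentiable (by simp) x
  have h2 : HasFDerivAt (fun y => Lr (fderiv ℝ φ y)) (Lr.comp (fderiv ℝ (fderiv ℝ φ) x)) x :=
    Lr.hasFDerivAt.comp x hd.hasFDerivAt
  rw [h1, h2.fderiv, ContinuousLinearMap.comp_apply, hLapp, InnerProductSpace.toDual_symm_apply]


/-- The scalar triple product is cyclic: `⟪a, b × c⟫ = ⟪c, a × b⟫`. [folklore] -/
private theorem inner_cross_cyclic (a b c : EuclideanSpace ℝ (Fin 3)) : ⟪a, cross b c⟫ = ⟪c, cross a b⟫ := by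
  simp only [cross, PiLp.inner_apply, cross_apply, RCLike.inner_apply, conj_trivial,
    Fin.sum_univ_three, Matrix.cons_val_zero, Matrix.cons_val_one, Matrix.cons_val_two,
    Matrix.head_cons, Matrix.tail_cons]
  ring

/-- `⟪v, v × w⟫ = 0`. [folklore] -/
private theorem inner_self_cross (v w : EuclideanSpace ℝ (Fin 3)) : ⟪v, cross v w⟫ = 0 := by
  simp only [cross, PiLp.inner_apply, cross_apply, RCLike.inner_apply, conj_trivial,
    Fin.sum_univ_three, Matrix.cons_val_zero, Matrix.cons_val_one, Matrix.cons_val_two,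
    Matrix.head_cons, Matrix.tail_cons]
  ring

/-- `x × ·` is skew-adjoint: `⟪x × v, w⟫ = −⟪v, x × w⟫`. [folklore] -/
private theorem inner_crossCLM_skew (z v w : EuclideanSpace ℝ (Fin 3)) :
    ⟪crossCLM z v, w⟫ = -⟪v, crossCLM z w⟫ := by
  simp only [crossCLM_apply, cross, PiLp.inner_apply, cross_apply, RCLike.inner_apply,
    conj_trivial, Fin.sum_univ_three, Matrix.cons_val_zero, Matrix.cons_val_one,
    Matrix.cons_val_two, Matrix.head_cons, Matrix.tail_cons]
  ring

/-- **Toroidal fields are divergence free**: `div (x × ∇φ(x)) = −Σ_i D²φ(x)(e_i, x × e_i) = 0`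
(a symmetric form traced against the skew map `x × ·`; the term `Σ_i ⟪e_i, e_i × ∇φ⟫` vanishes
identically). [folklore] -/
theorem isDivFree_crossSelf_gradient (hφ : ContDiff ℝ ∞ φ) :
    VectorCalculus.IsDivFree fun y => cross y (gradient φ y) := by
  intro x
  have hG : DifferentiableAt ℝ (gradient φ) x := (contDiff_gradient hφ).differentiable (by simp) x
  rw [divergence_eq_sum_inner_fderiv (EuclideanSpace.basisFun (Fin 3) ℝ)]
  simp only [fderiv_crossSelf_apply hG, inner_add_right, inner_self_cross, zero_add]
  have h1 : ∀ i, ⟪(EuclideanSpace.basisFun (Fin 3) ℝ) i,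
      cross x (fderiv ℝ (gradient φ) x ((EuclideanSpace.basisFun (Fin 3) ℝ) i))⟫ =
      -fderiv ℝ (fderiv ℝ φ) x (crossCLM x ((EuclideanSpace.basisFun (Fin 3) ℝ) i))
        ((EuclideanSpace.basisFun (Fin 3) ℝ) i) := fun i => by
    rw [inner_cross_cyclic, cross_swap, inner_neg_right, ← crossCLM_apply,
      inner_fderiv_gradient_apply hφ, fderiv_fderiv_symm hφ]
  simp only [h1, Finset.sum_neg_distrib, neg_eq_zero]
  exact sum_apply_clm_apply_eq_zero_of_skew (EuclideanSpace.basisFun (Fin 3) ℝ)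
    (fderiv ℝ (fderiv ℝ φ) x) (fun v w => fderiv_fderiv_symm hφ x v w) (inner_crossCLM_skew x)

/-- **Radially cut-off toroidal fields are divergence free**:
`div(χ(‖x‖²) x × ∇φ(x)) = χ · 0 + 2χ' ⟪x, x × ∇φ⟫ = 0`. [folklore] -/
theorem isDivFree_radial_crossSelf_gradient (hχ : Differentiable ℝ χ) (hφ : ContDiff ℝ ∞ φ) :
    VectorCalculus.IsDivFree fun y : EuclideanSpace ℝ (Fin 3) =>
      χ (‖y‖ ^ 2) • cross y (gradient φ y) := by
  intro x
  have hn : Differentiable ℝ fun y : EuclideanSpace ℝ (Fin 3) => ‖y‖ ^ 2 :=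
    (contDiff_norm_sq ℝ (n := 1)).differentiable one_ne_zero
  have hc : DifferentiableAt ℝ (fun y : EuclideanSpace ℝ (Fin 3) => χ (‖y‖ ^ 2)) x :=
    (hχ.comp hn) x
  have hT : DifferentiableAt ℝ (fun y => cross y (gradient φ y)) x :=
    (contDiff_crossSelf (contDiff_gradient hφ)).differentiable (by simp) x
  rw [Shvydkoy2018.divergence_smul_apply (EuclideanSpace.basisFun (Fin 3) ℝ) hc hT,
    isDivFree_crossSelf_gradient hφ x, mul_zero, zero_add, cross_swap, map_neg,
    fderiv_radial_apply_cross hχ, neg_zero]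

end Toroidal

end Summit.NavierStokesRegularity.AngularGalerkinLadderToroidalLift

end
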